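import Summits.KontsevichZagierPeriods.KontsevichZagierPeriods.Theorems.SoloInformedGeneralQuadratic
import HarnessLib
import HarnessLib.Audit

/-!
# SoloInformed — `∫ (A + B√(ax² + bx + c))/C dx` for EVERY quadratic (or linear, or constant) over `K`

Solo programme `solo-KontsevichZagierPeriods-informed`, session s112, file 34.

File 33 treats `a ≠ 0`, `b² ≠ 4ac`.  The degenerate cases: `b² = 4ac`, `a > 0`: `√q = √a·|x − β|`,
piecewise `K`-rational (two pieces, file 31); `b² = 4ac`, `a < 0`: `q ≥ 0` forces `D ⊆ {β}`, a null
set, so `[r]` is a relation; `a = 0`, `b ≠ 0`: the affine move `u = bx + c` lands in the radical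
class `K(u^{1/2})` of file 24; `a = b = 0`: constant `√c ∈ K`.  THEOREM
(`soloInformed_kzp_sqrt_anyQuadratic`): **for all `a, b, c ∈ K = ℝ ∩ ℚ̄` and `A, B, C ∈ K[X]`, every
absolutely convergent `∫_D (A + B√(ax² + bx + c))/C dx` over a `ℚ`-semialgebraic `D ⊆ {ax²+bx+c ≥ 0}`
with `C ≠ 0` on `D` is KZ-equivalent to every elementary one-variable integral, every rational
representation of dimension `≤ 1`, every other such integral, and every member of the span of
points and segments with the same value.**  Unconditional.

References: M. Kontsevich, D. Zagier, *Periods* (2001), §1.1–1.2; A. Baker (1975), Thm. 2.1.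
-/

noncomputable section

open scoped BigOperators Polynomial

namespace Summit.KontsevichZagierPeriods.KontsevichZagierPeriods.Theorems

open Set MeasureTheory
open Literature.ModelTheory.ExponentialFields
open Literature.NumberTheory.Transcendental Literature.NumberTheory.Transcendental.KZ

/-- A null-domain representation lies in the span (it is a relation). -/
theorem soloInformed_segSpan_of_volume_eq_zero {n : ℕ} (r : IntegralRep n) (h : volume r.domain = 0) :
    of r ∈ soloInformedSegSpan :=
  soloInformed_mem_segSpan_of_sub_mem (y := 0)
    (by rw [sub_zero]; exact of_mem_relations_of_volume_eq_zero r h) soloInformedSegSpan.zero_mem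

/-- A one-dimensional domain contained in a point is null. -/
theorem soloInformed_volume_eq_zero_of_subset_pt (D : Set (Fin 1 → ℝ)) (p : ℝ)
    (h : ∀ x ∈ D, x 0 = p) : volume D = 0 := by
  have hmp := volume_preserving_funUnique (Fin 1) ℝ
  have hsub : D ⊆ (MeasurableEquiv.funUnique (Fin 1) ℝ) ⁻¹' {p} := fun x hx => by
    simp [MeasurableEquiv.funUnique, Fin.default_eq_zero, h x hx]
  refine measure_mono_null hsub ?_
  exact (hmp.measure_preimage (measurableSet_singleton p).nullMeasurableSet).trans Real.volume_singleton

/-- `algebraMap |α| = |algebraMap α|` for `α ∈ K`. -/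
theorem soloInformed_algebraMap_abs_K (α : algebraicClosure ℚ ℝ) :
    (algebraMap (algebraicClosure ℚ ℝ) ℝ |α| : ℝ) = |algebraMap (algebraicClosure ℚ ℝ) ℝ α| := by
  rcases le_or_gt 0 α with h | h
  · rw [abs_of_nonneg h, abs_of_nonneg]
    exact_mod_cast h
  · rw [abs_of_neg h, map_neg, abs_of_neg]
    exact_mod_cast h

/-! ## The degenerate cases -/

/-- `b² = 4ac`, `a > 0`: `√q = √a·|x − β|`, piecewise `K`-rational. -/
theorem soloInformed_segSpan_of_sqrt_squareQuadratic (r : IntegralRep 1)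
    (a b c : algebraicClosure ℚ ℝ) (A B C : (algebraicClosure ℚ ℝ)[X])
    (hap : 0 < algebraMap _ ℝ a)
    (hΔ : algebraMap _ ℝ b ^ 2 - 4 * algebraMap _ ℝ a * algebraMap _ ℝ c = 0)
    (hC : ∀ x ∈ r.domain, (Polynomial.aeval (x 0) C : ℝ) ≠ 0)
    (hf : EqOn r.integrand (fun x => ((Polynomial.aeval (x 0) A : ℝ) + Polynomial.aeval (x 0) B *
      Real.sqrt (algebraMap _ ℝ a * x 0 ^ 2 + algebraMap _ ℝ b * x 0 + algebraMap _ ℝ c)) /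
      Polynomial.aeval (x 0) C) r.domain) :
    of r ∈ soloInformedSegSpan := by
  have hK := soloInformed_isAlgebraic_algebraMap_K
  set β : algebraicClosure ℚ ℝ := -b / (2 * a) with hβdef
  have hβ : algebraMap (algebraicClosure ℚ ℝ) ℝ β = -algebraMap _ ℝ b / (2 * algebraMap _ ℝ a) := by
    rw [hβdef, map_div₀, map_neg, map_mul, map_ofNat]
  obtain ⟨t, ht0, htt⟩ := soloInformed_exists_K_sqrt a hap.le
  have hid : ∀ x : ℝ, algebraMap _ ℝ a * x ^ 2 + algebraMap _ ℝ b * x + algebraMap _ ℝ c =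
      algebraMap (algebraicClosure ℚ ℝ) ℝ a * (x - algebraMap (algebraicClosure ℚ ℝ) ℝ β) ^ 2 := fun x => by
    rw [hβ, soloInformed_complete_square hap.ne', hΔ, zero_div, sub_zero]
  have hroot : ∀ x : ℝ, Real.sqrt (algebraMap _ ℝ a * x ^ 2 + algebraMap _ ℝ b * x + algebraMap _ ℝ c) =
      algebraMap (algebraicClosure ℚ ℝ) ℝ t * |x - algebraMap (algebraicClosure ℚ ℝ) ℝ β| := fun x => by
    rw [hid, soloInformed_sqrt_mul_of_sq ht0 htt, Real.sqrt_sq_eq_abs]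
  set S : Set (Fin 1 → ℝ) := {x | x ∈ r.domain ∧ x 0 ≤ algebraMap _ ℝ β} with hSdef
  set T : Set (Fin 1 → ℝ) := {x | x ∈ r.domain ∧ algebraMap _ ℝ β < x 0} with hTdef
  have hS : IsSemialgebraic ℚ S := by
    have h := (soloInformed_isSemialgebraicFunOn_aevalK hK r.isSemialgebraic_domain
      (MvPolynomial.C β - MvPolynomial.X 0 : MvPolynomial (Fin 1) (algebraicClosure ℚ ℝ))).isSemialgebraic_sep_nonneg
    convert h using 2 with x
    simp [sub_nonneg]
  have hT : IsSemialgebraic ℚ T := by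
    have h := (soloInformed_isSemialgebraicFunOn_aevalK hK r.isSemialgebraic_domain
      (MvPolynomial.C β - MvPolynomial.X 0 : MvPolynomial (Fin 1) (algebraicClosure ℚ ℝ))).isSemialgebraic_sep_neg
    convert h using 2 with x
    simp [sub_neg]
  refine soloInformed_segSpan_of_two_pieces r S T hS hT (fun x hx => hx.1) (fun x hx => hx.1)
    (fun x hx => ?_) ?_ ?_ ?_
  · rcases le_or_gt (x 0) (algebraMap (algebraicClosure ℚ ℝ) ℝ β) with h | h
    · exact Or.inl ⟨hx, h⟩
    · exact Or.inr ⟨hx, h⟩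
  · refine Set.eq_empty_iff_forall_notMem.2 fun x hx => ?_
    have h1 := hx.1.2
    have h2 := hx.2.2
    linarith
  · refine soloInformed_segSpan_of_isKRationalOne _
      ⟨A + B * Polynomial.C t * (Polynomial.C β - Polynomial.X), C, fun x hx => hC x hx.1, fun x hx => ?_⟩
    show r.integrand x = _
    rw [hf hx.1]
    show ((Polynomial.aeval (x 0) A : ℝ) + Polynomial.aeval (x 0) B *
        Real.sqrt (algebraMap _ ℝ a * x 0 ^ 2 + algebraMap _ ℝ b * x 0 + algebraMap _ ℝ c)) /
        Polynomial.aeval (x 0) C = _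
    rw [hroot, abs_of_nonpos (sub_nonpos.2 hx.2)]
    simp only [map_add, map_mul, map_sub, Polynomial.aeval_C, Polynomial.aeval_X]
    ring
  · refine soloInformed_segSpan_of_isKRationalOne _
      ⟨A + B * Polynomial.C t * (Polynomial.X - Polynomial.C β), C, fun x hx => hC x hx.1, fun x hx => ?_⟩
    show r.integrand x = _
    rw [hf hx.1]
    show ((Polynomial.aeval (x 0) A : ℝ) + Polynomial.aeval (x 0) B *
        Real.sqrt (algebraMap _ ℝ a * x 0 ^ 2 + algebraMap _ ℝ b * x 0 + algebraMap _ ℝ c)) /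
        Polynomial.aeval (x 0) C = _
    rw [hroot, abs_of_pos (sub_pos.2 hx.2)]
    simp only [map_add, map_mul, map_sub, Polynomial.aeval_C, Polynomial.aeval_X]
    ring

/-- `a = 0`, `b ≠ 0`: after `u = bx + c` the integrand is rational in `u^{1/2}` (file 24). -/
theorem soloInformed_segSpan_of_sqrt_linear (r : IntegralRep 1)
    (b c : algebraicClosure ℚ ℝ) (A B C : (algebraicClosure ℚ ℝ)[X]) (hb : algebraMap _ ℝ b ≠ 0)
    (hq : ∀ x ∈ r.domain, 0 ≤ algebraMap _ ℝ b * x 0 + algebraMap _ ℝ c)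
    (hC : ∀ x ∈ r.domain, (Polynomial.aeval (x 0) C : ℝ) ≠ 0)
    (hf : EqOn r.integrand (fun x => ((Polynomial.aeval (x 0) A : ℝ) + Polynomial.aeval (x 0) B *
      Real.sqrt (algebraMap _ ℝ b * x 0 + algebraMap _ ℝ c)) / Polynomial.aeval (x 0) C) r.domain) :
    of r ∈ soloInformedSegSpan := by
  have hb0 : b ≠ 0 := fun h => hb (by rw [h, map_zero])
  set α : algebraicClosure ℚ ℝ := 1 / b with hαdef
  set β : algebraicClosure ℚ ℝ := -c / b with hβdef
  have hα : algebraMap (algebraicClosure ℚ ℝ) ℝ α = 1 / algebraMap _ ℝ b := by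
    rw [hαdef, map_div₀, map_one]
  have hβ : algebraMap (algebraicClosure ℚ ℝ) ℝ β = -algebraMap _ ℝ c / algebraMap _ ℝ b := by
    rw [hβdef, map_div₀, map_neg]
  have hαne : algebraMap (algebraicClosure ℚ ℝ) ℝ α ≠ 0 := by rw [hα]; exact div_ne_zero one_ne_zero hb
  obtain ⟨R', hdom, hint, hrel⟩ := soloInformed_exists_affineSubst α β hαne r
  refine soloInformed_segSpan_of_subst hrel
    (soloInformed_segSpan_of_isKRadicalOne (m := 2) two_ne_zero R' ?_)
  have hpt : ∀ u : Fin 1 → ℝ, soloInformedScaleMoveR 0 (algebraMap (algebraicClosure ℚ ℝ) ℝ β)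
      (algebraMap (algebraicClosure ℚ ℝ) ℝ α) u 0 = algebraMap _ ℝ β + algebraMap _ ℝ α * u 0 :=
    fun u => (soloInformed_affine_apply _ _ u).1
  have hdet : |(soloInformedScaleDerivR (n := 1) 0 (algebraMap (algebraicClosure ℚ ℝ) ℝ α)).det| =
      |algebraMap (algebraicClosure ℚ ℝ) ℝ α| :=
    (soloInformed_affine_apply (algebraMap _ ℝ α) (algebraMap (algebraicClosure ℚ ℝ) ℝ β) 0).2
  have hmem : ∀ u ∈ R'.domain, soloInformedScaleMoveR 0 (algebraMap (algebraicClosure ℚ ℝ) ℝ β)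
      (algebraMap (algebraicClosure ℚ ℝ) ℝ α) u ∈ r.domain := fun u hu => by
    rw [hdom] at hu; exact hu.2
  -- `b·x(u) + c = u`
  have hlin : ∀ u : ℝ, algebraMap (algebraicClosure ℚ ℝ) ℝ b * (algebraMap _ ℝ β + algebraMap _ ℝ α * u) +
      algebraMap _ ℝ c = u := fun u => by
    rw [hα, hβ]; field_simp; ring
  have hu0 : ∀ u ∈ R'.domain, 0 ≤ u 0 := fun u hu => by
    have h := hq _ (hmem u hu)
    rwa [hpt, hlin] at h
  -- `σ = u^{1/2}`: `σ² = u`, `σ = √u`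
  have hσ : ∀ {u : ℝ}, 0 ≤ u → (u ^ ((2 : ℕ) : ℝ)⁻¹) ^ 2 = u ∧ Real.sqrt u = u ^ ((2 : ℕ) : ℝ)⁻¹ :=
    fun {u} hu => ⟨Real.rpow_inv_natCast_pow hu two_ne_zero, by
      rw [Real.sqrt_eq_rpow]; norm_num⟩
  set L : (algebraicClosure ℚ ℝ)[X] → (algebraicClosure ℚ ℝ)[X] :=
    fun P => (soloInformedAffComp α β P).comp (Polynomial.X ^ 2) with hLdef
  have hL : ∀ (P : (algebraicClosure ℚ ℝ)[X]) {u : ℝ}, 0 ≤ u →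
      (Polynomial.aeval (u ^ ((2 : ℕ) : ℝ)⁻¹) (L P) : ℝ) =
        Polynomial.aeval (algebraMap _ ℝ β + algebraMap _ ℝ α * u) P := fun P u hu => by
    rw [hLdef]
    show (Polynomial.aeval (u ^ ((2 : ℕ) : ℝ)⁻¹) ((soloInformedAffComp α β P).comp (Polynomial.X ^ 2)) : ℝ) = _
    rw [Polynomial.aeval_comp, map_pow, Polynomial.aeval_X, (hσ hu).1, soloInformed_aeval_affComp]
  refine ⟨Polynomial.C |α| * L A + Polynomial.C |α| * L B * Polynomial.X, L C, fun u hu => ⟨hu0 u hu, ?_⟩,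
    fun u hu => ?_⟩
  · rw [hL C (hu0 u hu), ← hpt u]
    exact hC _ (hmem u hu)
  · rw [hint]
    show r.integrand _ * _ = _
    rw [hdet, hf (hmem u hu)]
    show ((Polynomial.aeval (soloInformedScaleMoveR 0 _ _ u 0) A : ℝ) +
        Polynomial.aeval (soloInformedScaleMoveR 0 _ _ u 0) B *
          Real.sqrt (algebraMap _ ℝ b * soloInformedScaleMoveR 0 _ _ u 0 + algebraMap _ ℝ c)) /
        Polynomial.aeval (soloInformedScaleMoveR 0 _ _ u 0) C * |algebraMap (algebraicClosure ℚ ℝ) ℝ α| = _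
    rw [hpt u, hlin, (hσ (hu0 u hu)).2]
    simp only [map_add, map_mul, Polynomial.aeval_C, Polynomial.aeval_X, hL _ (hu0 u hu),
      soloInformed_algebraMap_abs_K]
    rw [div_mul_eq_mul_div]
    ring

/-- `a = b = 0`: the radical is the constant `√c` (`∈ K`; `= 0` if `c < 0`). -/
theorem soloInformed_segSpan_of_sqrt_const (r : IntegralRep 1)
    (c : algebraicClosure ℚ ℝ) (A B C : (algebraicClosure ℚ ℝ)[X])
    (hC : ∀ x ∈ r.domain, (Polynomial.aeval (x 0) C : ℝ) ≠ 0)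
    (hf : EqOn r.integrand (fun x => ((Polynomial.aeval (x 0) A : ℝ) + Polynomial.aeval (x 0) B *
      Real.sqrt (algebraMap _ ℝ c)) / Polynomial.aeval (x 0) C) r.domain) :
    of r ∈ soloInformedSegSpan := by
  obtain ⟨t, ht⟩ : ∃ t : algebraicClosure ℚ ℝ, algebraMap _ ℝ t = Real.sqrt (algebraMap _ ℝ c) := by
    rcases le_or_gt 0 (algebraMap (algebraicClosure ℚ ℝ) ℝ c) with h | h
    · obtain ⟨t, ht0, htt⟩ := soloInformed_exists_K_sqrt c h
      exact ⟨t, by rw [← Real.sqrt_mul_self ht0, htt]⟩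
    · exact ⟨0, by rw [map_zero, Real.sqrt_eq_zero'.2 h.le]⟩
  refine soloInformed_segSpan_of_isKRationalOne _ ⟨A + B * Polynomial.C t, C, hC, fun x hx => ?_⟩
  show r.integrand x = _
  rw [hf hx]
  show ((Polynomial.aeval (x 0) A : ℝ) + Polynomial.aeval (x 0) B * Real.sqrt (algebraMap _ ℝ c)) /
      Polynomial.aeval (x 0) C = _
  simp only [map_add, map_mul, Polynomial.aeval_C, ht]

/-! ## Every quadratic -/

/-- **`(A + B√(ax² + bx + c))/C` on `D ⊆ {q ≥ 0}` lies in the span of points and segments, for ALL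
`a, b, c ∈ K`** (`C ≠ 0` on `D`). -/
theorem soloInformed_segSpan_of_sqrt_anyQuadratic (r : IntegralRep 1)
    (a b c : algebraicClosure ℚ ℝ) (A B C : (algebraicClosure ℚ ℝ)[X])
    (hq : ∀ x ∈ r.domain, 0 ≤ algebraMap _ ℝ a * x 0 ^ 2 + algebraMap _ ℝ b * x 0 + algebraMap _ ℝ c)
    (hC : ∀ x ∈ r.domain, (Polynomial.aeval (x 0) C : ℝ) ≠ 0)
    (hf : EqOn r.integrand (fun x => ((Polynomial.aeval (x 0) A : ℝ) + Polynomial.aeval (x 0) B *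
      Real.sqrt (algebraMap _ ℝ a * x 0 ^ 2 + algebraMap _ ℝ b * x 0 + algebraMap _ ℝ c)) /
      Polynomial.aeval (x 0) C) r.domain) :
    of r ∈ soloInformedSegSpan := by
  by_cases ha : algebraMap (algebraicClosure ℚ ℝ) ℝ a = 0
  · -- linear or constant
    by_cases hb : algebraMap (algebraicClosure ℚ ℝ) ℝ b = 0
    · refine soloInformed_segSpan_of_sqrt_const r c A B C hC fun x hx => ?_
      rw [hf hx]
      show _ = ((Polynomial.aeval (x 0) A : ℝ) + Polynomial.aeval (x 0) B * Real.sqrt (algebraMap _ ℝ c)) /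
        Polynomial.aeval (x 0) C
      simp only [ha, hb, zero_mul, zero_add]
    · refine soloInformed_segSpan_of_sqrt_linear r b c A B C hb (fun x hx => ?_) hC fun x hx => ?_
      · have h := hq x hx
        rwa [ha, zero_mul, zero_add] at h
      · rw [hf hx]
        show _ = ((Polynomial.aeval (x 0) A : ℝ) + Polynomial.aeval (x 0) B *
          Real.sqrt (algebraMap _ ℝ b * x 0 + algebraMap _ ℝ c)) / Polynomial.aeval (x 0) C
        simp only [ha, zero_mul, zero_add]
  · by_cases hΔ : algebraMap (algebraicClosure ℚ ℝ) ℝ b ^ 2 - 4 * algebraMap _ ℝ a * algebraMap _ ℝ c = 0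
    · rcases lt_or_gt_of_ne ha with han | hap
      · -- `a < 0`, `Δ = 0`: `q = a(x − β)² ≥ 0` forces `x = β`
        refine soloInformed_segSpan_of_volume_eq_zero r (soloInformed_volume_eq_zero_of_subset_pt _
          (-algebraMap _ ℝ b / (2 * algebraMap (algebraicClosure ℚ ℝ) ℝ a)) fun x hx => ?_)
        have h := hq x hx
        rw [soloInformed_complete_square ha, hΔ, zero_div, sub_zero] at h
        have h2 : (x 0 - -algebraMap (algebraicClosure ℚ ℝ) ℝ b / (2 * algebraMap _ ℝ a)) ^ 2 ≤ 0 := by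
          by_contra hne
          have hpos : 0 < (x 0 - -algebraMap (algebraicClosure ℚ ℝ) ℝ b / (2 * algebraMap _ ℝ a)) ^ 2 :=
            lt_of_not_ge hne
          nlinarith
        have h3 := le_antisymm h2 (sq_nonneg _)
        exact sub_eq_zero.1 (pow_eq_zero_iff two_ne_zero |>.1 h3)
      · exact soloInformed_segSpan_of_sqrt_squareQuadratic r a b c A B C hap hΔ hC hf
    · exact soloInformed_segSpan_of_sqrt_generalQuadratic r a b c A B C ha hΔ hq hC hf

/-- **The period conjecture for `∫_D (A + B√(ax² + bx + c))/C dx`, EVERY `a, b, c ∈ K`,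
`D ⊆ {ax² + bx + c ≥ 0}`, `C ≠ 0` on `D`:** KZ-equivalent to every elementary one-variable integral,
every rational representation of dimension `≤ 1`, and every member of the span of points and
segments with the same value.  Unconditional. [Kontsevich–Zagier 2001, §1.2 Question 1; this work] -/
theorem soloInformed_kzp_sqrt_anyQuadratic (r : IntegralRep 1)
    (a b c : algebraicClosure ℚ ℝ) (A B C : (algebraicClosure ℚ ℝ)[X])
    (hq : ∀ x ∈ r.domain, 0 ≤ algebraMap _ ℝ a * x 0 ^ 2 + algebraMap _ ℝ b * x 0 + algebraMap _ ℝ c)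
    (hC : ∀ x ∈ r.domain, (Polynomial.aeval (x 0) C : ℝ) ≠ 0)
    (hf : EqOn r.integrand (fun x => ((Polynomial.aeval (x 0) A : ℝ) + Polynomial.aeval (x 0) B *
      Real.sqrt (algebraMap _ ℝ a * x 0 ^ 2 + algebraMap _ ℝ b * x 0 + algebraMap _ ℝ c)) /
      Polynomial.aeval (x 0) C) r.domain) :
    (∀ r₁ : IntegralRep 1, SoloInformedIsKElementaryOne r₁ → r.value = r₁.value → Equivalent r r₁) ∧
    (∀ {n : ℕ} (hn : n ≤ 1) (r₀ : IntegralRep n), r₀.IsRational → r.value = r₀.value →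
      Equivalent r r₀) ∧
    (∀ {m : ℕ} (r₂ : IntegralRep m), of r₂ ∈ soloInformedSegSpan → r.value = r₂.value →
      Equivalent r r₂) := by
  have h := soloInformed_segSpan_of_sqrt_anyQuadratic r a b c A B C hq hC hf
  exact ⟨fun r₁ hr₁ hv => soloInformed_equivalent_of_mem_segSpan h
      (soloInformed_segSpan_of_isKElementaryOne r₁ hr₁) hv,
    fun hn r₀ hr₀ hv => soloInformed_equivalent_of_mem_segSpan h
      (soloInformed_of_mem_segSpan_of_isRational hn r₀ hr₀) hv,
    fun r₂ hr₂ hv => soloInformed_equivalent_of_mem_segSpan h hr₂ hv⟩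

/-- Two such integrals (any quadratics over `K`) with equal values are KZ-equivalent. -/
theorem soloInformed_kzp_sqrt_anyQuadratic_pair (r r' : IntegralRep 1)
    (a b c a₁ b₁ c₁ : algebraicClosure ℚ ℝ) (A B C A₁ B₁ C₁ : (algebraicClosure ℚ ℝ)[X])
    (hq : ∀ x ∈ r.domain, 0 ≤ algebraMap _ ℝ a * x 0 ^ 2 + algebraMap _ ℝ b * x 0 + algebraMap _ ℝ c)
    (hC : ∀ x ∈ r.domain, (Polynomial.aeval (x 0) C : ℝ) ≠ 0)
    (hf : EqOn r.integrand (fun x => ((Polynomial.aeval (x 0) A : ℝ) + Polynomial.aeval (x 0) B *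
      Real.sqrt (algebraMap _ ℝ a * x 0 ^ 2 + algebraMap _ ℝ b * x 0 + algebraMap _ ℝ c)) /
      Polynomial.aeval (x 0) C) r.domain)
    (hq₁ : ∀ x ∈ r'.domain, 0 ≤ algebraMap _ ℝ a₁ * x 0 ^ 2 + algebraMap _ ℝ b₁ * x 0 + algebraMap _ ℝ c₁)
    (hC₁ : ∀ x ∈ r'.domain, (Polynomial.aeval (x 0) C₁ : ℝ) ≠ 0)
    (hf₁ : EqOn r'.integrand (fun x => ((Polynomial.aeval (x 0) A₁ : ℝ) + Polynomial.aeval (x 0) B₁ *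
      Real.sqrt (algebraMap _ ℝ a₁ * x 0 ^ 2 + algebraMap _ ℝ b₁ * x 0 + algebraMap _ ℝ c₁)) /
      Polynomial.aeval (x 0) C₁) r'.domain)
    (hv : r.value = r'.value) : Equivalent r r' :=
  soloInformed_equivalent_of_mem_segSpan
    (soloInformed_segSpan_of_sqrt_anyQuadratic r a b c A B C hq hC hf)
    (soloInformed_segSpan_of_sqrt_anyQuadratic r' a₁ b₁ c₁ A₁ B₁ C₁ hq₁ hC₁ hf₁) hv

end Summit.KontsevichZagierPeriods.KontsevichZagierPeriods.Theorems
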